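import Summits.BirchSwinnertonDyer.Rank1Residual.Ordinary.Conjectures.KolyvaginClassDatum
import HarnessLib

/-!
# Normal forms for the Kolyvagin-class datum: ONE identification at `p` suffices for Kim's reading, and the bottom class
# `κ(Q)` is `κ((p^a·u)·P)` with `u : ℕ`, `p ∤ u`, without loss (theorems only; nothing asserted; C-16 stays a CONJECTURE)

HONEST FRAMING (cell `b2b-bsdres`, run/shared/lean/b2b/bsd-rank1-residual/, verbatim in every
file): the goal of the cell is to DELETE the COMBINATION-SHAPED residual classes of the
Birch–Swinnerton-Dyer formula for ALL analytic-rank `≤ 1` elliptic curves over `ℚ` — "full BSD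
formula for every rank `≤ 1` curve in class `C`" assembled STRICTLY from published theorems — so
that the rank-`≤ 1` remainder becomes exactly the CONSTRUCTION-SHAPED classes, which are TYPED
(missing-input `Prop`s), NOT attempted. This is not "finishing BSD". Seat `b2b-bsdres-additive-p3`
(X8 prover B / X7 joint; typer-designate for the cell conjecture C-16 = hyp C120.1; ladder BSD:K3 hand-off to cell
`bsd-ssimc`). This file books nothing and moves no mark; X7 / X8 stay CONSTRUCTION-SHAPED; C-16 = CONJECTURE.

## What this file does

Two conveniences for whoever types the ONE residual input of C-16 (`KolyvaginKimDatum`, `Conjectures/KolyvaginClassDatum.lean`;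
from a Kolyvagin system, `Conjectures/KolyvaginKimDatumOfKolyvaginSystem.lean`) from print (Mazur–Rubin Thm. 3.2.4 / 5.2.12, Kim
Thm. 3.13):

* §1 `KSDatum.kimReading_forall_of_one`: Kim's reading `ord_p(δ̃ mod p^k) = min(k, ord_p ψ_p[loc_p x])` is demanded for EVERY
  identification `ψ_p` of the singular quotient at `p` with `ℤ/p^n`; since two identifications differ by a unit
  (`ReciprocityPT.zmodPowOrd_addEquiv_congr`), it suffices to check it for ONE (the identification the source prints).
* §2 the bottom class: the consumers display `κ_1 = κ_{p^n}((p^a·u)·P)` with `u : ℕ`, `p ∤ u`, while print gives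
  `κ_1 = κ(c·P)` for an integer (or `p`-adic integer) `c` with `ord_p c = a`, and a generator `P` of `E(ℚ)` MODULO TORSION. With no
  rational `p`-torsion nothing is lost: `kummerMapTorsion_eq_zero_of_isOfFinAddOrder` (a torsion point has order prime to `p`, hence is
  `p^n`-divisible in `E(ℚ)`, so its Kummer class vanishes — exactness `ker κ = p^n E(ℚ)`, tree `kummerMapTorsion_ker`),
  `kummerMapTorsion_eq_of_sub_mem_range` (classes of points congruent mod `p^n E(ℚ)` agree),
  `exists_unit_nat_kummerMapTorsion_pow_mul_eq` (for `c' : ℤ` prime to `p` there is `u : ℕ`, `p ∤ u`, with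
  `κ((p^a c')·P) = κ((p^a u)·P)`), and the assembled `exists_unit_nat_kummerMapTorsion_eq_of_generator`: if `E(ℚ)[p] = 0` and
  `Q − (p^a c')·P` is torsion with `p ∤ c'`, then `κ(Q) = κ((p^a·u)·P)` for some `u : ℕ` with `p ∤ u`.

References: B. Mazur, K. Rubin, Mem. AMS 799 (2004), Thm. 5.2.12 [MazurRubin2004]; C.-H. Kim, arXiv:2203.12159, Thm. 3.13, (5.3)
[Kim2022StructureSelmer]; J. H. Silverman, AEC (2009) VIII.§2 (Kummer sequence) [SilvermanAEC2009].
-/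

noncomputable section

open scoped Classical

open WeierstrassCurve Literature.NumberTheory.EllipticCurves Literature.NumberTheory.GaloisRepresentations
  Function NumberField IsDedekindDomain

namespace Summit.BirchSwinnertonDyer.Rank1Residual.Ordinary

/-! ### §1 Kim's reading: one identification suffices -/

section OneIdentification

/-- **One identification suffices.** If a reading `r = min k (ord_p (ψ₀ z))` holds for ONE identification `ψ₀ : C ≅ ℤ/p^n`, it
holds for every identification `ψ` (two identifications differ by a unit of `ℤ/p^n`, which does not change `ord_p`).
[cite: Kim2022StructureSelmer, Thm. 3.13 and (5.3)] -/
theorem KSDatum.kimReading_forall_of_one {C : Type*} [AddCommGroup C] {p n k r : ℕ} (hp : p.Prime)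
    (ψ₀ : C ≃+ ZMod (p ^ n)) (z : C) (h : r = min k (zmodPowOrd p n (ψ₀ z))) (ψ : C ≃+ ZMod (p ^ n)) :
    r = min k (zmodPowOrd p n (ψ z)) := by
  rw [h, ReciprocityPT.zmodPowOrd_addEquiv_congr hp ψ₀ ψ z]

/-- The same for a reading without the cap `min k`. [cite: Kim2022StructureSelmer, Thm. 3.13] -/
theorem KSDatum.zmodPowOrd_forall_of_one {C : Type*} [AddCommGroup C] {p n r : ℕ} (hp : p.Prime)
    (ψ₀ : C ≃+ ZMod (p ^ n)) (z : C) (h : r = zmodPowOrd p n (ψ₀ z)) (ψ : C ≃+ ZMod (p ^ n)) :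
    r = zmodPowOrd p n (ψ z) := by
  rw [h, ReciprocityPT.zmodPowOrd_addEquiv_congr hp ψ₀ ψ z]

end OneIdentification

/-! ### §2 The bottom class: torsion is invisible, and `u : ℕ` with `p ∤ u` is without loss -/

section BottomClass

variable {K : Type} [Field K] [PerfectField K] (W : WeierstrassCurve K) (m : ℤ)
  (hdiv : ∀ P : geomPoints W, ∃ R : geomPoints W, m • R = P)

/-- **Points congruent modulo `m·E(K)` have the same Kummer class** (exactness `ker κ_m = m E(K)`, tree
`kummerMapTorsion_ker`). [cite: SilvermanAEC2009, VIII.§2 (exactness of the Kummer sequence)] -/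
theorem kummerMapTorsion_eq_of_sub_mem_range {Q Q' : W.toAffine.Point}
    (h : Q - Q' ∈ (zsmulAddGroupHom (α := W.toAffine.Point) m).range) :
    kummerMapTorsion W m hdiv Q = kummerMapTorsion W m hdiv Q' := by
  rw [← sub_eq_zero, ← map_sub, ← AddMonoidHom.mem_ker, kummerMapTorsion_ker]
  exact h

/-- `κ_m(m·R) = 0`. [cite: SilvermanAEC2009, VIII.§2] -/
theorem kummerMapTorsion_zsmul_self (R : W.toAffine.Point) : kummerMapTorsion W m hdiv (m • R) = 0 := by
  rw [← AddMonoidHom.mem_ker, kummerMapTorsion_ker]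
  exact ⟨R, zsmulAddGroupHom_apply m R⟩

omit [PerfectField K] in
/-- **A torsion point of a group without `p`-torsion has order prime to `p`.** [folklore] -/
theorem KSDatum.not_dvd_addOrderOf_of_no_pTorsion {A : Type*} [AddCommGroup A] {p : ℕ} (hp : p.Prime)
    (htors : ∀ T : A, p • T = 0 → T = 0) {T : A} (hT : IsOfFinAddOrder T) : ¬ p ∣ addOrderOf T := by
  rintro ⟨m', hm'⟩
  have hpos : 0 < addOrderOf T := hT.addOrderOf_pos
  have hm'pos : 0 < m' := Nat.pos_of_ne_zero (by rintro rfl; rw [mul_zero] at hm'; omega)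
  have hkill : p • (m' • T) = 0 := by
    rw [smul_smul, ← hm']
    exact addOrderOf_nsmul_eq_zero T
  have hzero : m' • T = 0 := htors _ hkill
  have hdvd : addOrderOf T ∣ m' := addOrderOf_dvd_of_nsmul_eq_zero hzero
  have hle : addOrderOf T ≤ m' := Nat.le_of_dvd hm'pos hdvd
  have hlt : m' < addOrderOf T := by
    rw [hm']
    exact lt_mul_left hm'pos hp.one_lt
  omega

omit [PerfectField K] in
/-- **A torsion point of order prime to `p` is `p^n`-divisible inside the cyclic group it generates** (Bézout).
[folklore] -/
theorem KSDatum.exists_zsmul_eq_of_coprime_addOrderOf {A : Type*} [AddCommGroup A] {N : ℕ} {T : A}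
    (hT : IsOfFinAddOrder T) (hcop : Nat.Coprime N (addOrderOf T)) : ∃ R : A, (N : ℤ) • R = T := by
  obtain ⟨x, y, hxy⟩ := Nat.isCoprime_iff_coprime.mpr hcop
  refine ⟨x • T, ?_⟩
  have hord : ((addOrderOf T : ℕ) : ℤ) • T = 0 := by
    rw [natCast_zsmul]; exact addOrderOf_nsmul_eq_zero T
  have _ := hT
  have h1 : (N : ℤ) • x • T = (x * (N : ℤ)) • T := by rw [smul_smul, mul_comm]
  have h2 : (y * ((addOrderOf T : ℕ) : ℤ)) • T = 0 := by rw [← smul_smul, hord, smul_zero]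
  rw [h1, ← add_zero ((x * (N : ℤ)) • T), ← h2, ← add_smul, hxy, one_smul]

/-- **The Kummer class of a torsion point vanishes when `E(K)[p] = 0`** (`m = p^n`): its order is prime to `p`, so it is
`p^n`-divisible in `E(K)`, i.e. lies in `ker κ = p^n E(K)`. [cite: SilvermanAEC2009, VIII.§2] [cite: MazurRubin2004, Thm. 5.2.12] -/
theorem kummerMapTorsion_eq_zero_of_isOfFinAddOrder {p n : ℕ} (hp : p.Prime)
    (hdivp : ∀ P : geomPoints W, ∃ R : geomPoints W, ((p ^ n : ℕ) : ℤ) • R = P)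
    (htors : ∀ T : W.toAffine.Point, p • T = 0 → T = 0) {T : W.toAffine.Point} (hT : IsOfFinAddOrder T) :
    kummerMapTorsion W ((p ^ n : ℕ) : ℤ) hdivp T = 0 := by
  have hnd := KSDatum.not_dvd_addOrderOf_of_no_pTorsion hp htors hT
  have hcop : Nat.Coprime (p ^ n) (addOrderOf T) :=
    (Nat.Coprime.pow_left n ((hp.coprime_iff_not_dvd).mpr hnd))
  obtain ⟨R, hR⟩ := KSDatum.exists_zsmul_eq_of_coprime_addOrderOf hT hcop
  rw [← hR]
  exact kummerMapTorsion_zsmul_self W _ hdivp R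

/-- **`u : ℕ` with `p ∤ u` is without loss** (`n ≥ 1`): for `c' : ℤ` prime to `p` there is `u : ℕ`, `p ∤ u`, with
`κ_{p^n}((p^a·c')·P) = κ_{p^n}((p^a·u)·P)` — take `u ≡ c' (mod p^n)`, `0 ≤ u < p^n`; the two points differ by
`p^a (c' − u)·P ∈ p^n E(K)`. [cite: MazurRubin2004, Thm. 5.2.12] -/
theorem exists_unit_nat_kummerMapTorsion_pow_mul_eq {p n : ℕ} (hp : p.Prime) (hn : 1 ≤ n)
    (hdivp : ∀ P : geomPoints W, ∃ R : geomPoints W, ((p ^ n : ℕ) : ℤ) • R = P)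
    (P : W.toAffine.Point) (a : ℕ) {c' : ℤ} (hc' : ¬ (p : ℤ) ∣ c') :
    ∃ u : ℕ, ¬ p ∣ u ∧
      kummerMapTorsion W ((p ^ n : ℕ) : ℤ) hdivp (((p : ℤ) ^ a * c') • P) =
        kummerMapTorsion W ((p ^ n : ℕ) : ℤ) hdivp ((p ^ a * u) • P) := by
  have hN0 : (0 : ℤ) < ((p ^ n : ℕ) : ℤ) := by exact_mod_cast pow_pos hp.pos n
  set r : ℤ := c' % ((p ^ n : ℕ) : ℤ) with hr
  have hr0 : 0 ≤ r := Int.emod_nonneg _ hN0.ne'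
  have hrdvd : ((p ^ n : ℕ) : ℤ) ∣ c' - r := ⟨c' / ((p ^ n : ℕ) : ℤ), by rw [hr, Int.emod_def]; ring⟩
  refine ⟨r.toNat, ?_, ?_⟩
  · intro hu
    apply hc'
    have h1 : (p : ℤ) ∣ r := by
      rw [← Int.toNat_of_nonneg hr0]; exact_mod_cast hu
    have h2 : (p : ℤ) ∣ ((p ^ n : ℕ) : ℤ) := by
      rw [Nat.cast_pow]; exact dvd_pow_self (p : ℤ) (by omega)
    have h3 : (p : ℤ) ∣ c' - r := h2.trans hrdvd
    simpa using h3.add h1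
  · apply kummerMapTorsion_eq_of_sub_mem_range
    obtain ⟨t, ht⟩ := hrdvd
    refine ⟨((p : ℤ) ^ a * t) • P, ?_⟩
    rw [zsmulAddGroupHom_apply]
    have hu : ((p ^ a * r.toNat : ℕ) : ℤ) = (p : ℤ) ^ a * r := by
      push_cast; rw [Int.toNat_of_nonneg hr0]
    rw [← natCast_zsmul, hu, ← sub_smul, ← mul_sub, ht, smul_smul]
    congr 1
    ring

/-- **The displayed bottom class, assembled**: if `E(K)` has no `p`-torsion, `P, Q ∈ E(K)`, and `Q − (p^a·c')·P` is torsion for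
an integer `c'` prime to `p` (print: `κ_1 = p^a u·P` with `P` a generator MODULO TORSION, Mazur–Rubin Thm. 5.2.12), then
`κ_{p^n}(Q) = κ_{p^n}((p^a·u)·P)` for some `u : ℕ` with `p ∤ u` (`n ≥ 1`) — the form the consumers of `KolyvaginKimDatum` display.
[cite: MazurRubin2004, Thm. 5.2.12] [cite: SilvermanAEC2009, VIII.§2] -/
theorem exists_unit_nat_kummerMapTorsion_eq_of_generator {p n : ℕ} (hp : p.Prime) (hn : 1 ≤ n)
    (hdivp : ∀ P : geomPoints W, ∃ R : geomPoints W, ((p ^ n : ℕ) : ℤ) • R = P)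
    (htors : ∀ T : W.toAffine.Point, p • T = 0 → T = 0)
    (P Q : W.toAffine.Point) (a : ℕ) {c' : ℤ} (hc' : ¬ (p : ℤ) ∣ c')
    (hQ : IsOfFinAddOrder (Q - ((p : ℤ) ^ a * c') • P)) :
    ∃ u : ℕ, ¬ p ∣ u ∧
      kummerMapTorsion W ((p ^ n : ℕ) : ℤ) hdivp Q = kummerMapTorsion W ((p ^ n : ℕ) : ℤ) hdivp ((p ^ a * u) • P) := by
  obtain ⟨u, hu, hκ⟩ := exists_unit_nat_kummerMapTorsion_pow_mul_eq W hp hn hdivp P a hc'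
  refine ⟨u, hu, ?_⟩
  rw [← hκ]
  have h0 := kummerMapTorsion_eq_zero_of_isOfFinAddOrder W hp hdivp htors hQ
  rw [map_sub, sub_eq_zero] at h0
  exact h0

end BottomClass

end Summit.BirchSwinnertonDyer.Rank1Residual.Ordinary

end
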